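import Literature.MathematicalPhysics.QuantumFieldTheory.Balaban1983to89.B7BlockAvgLog
import Literature.MathematicalPhysics.QuantumFieldTheory.Balaban1983to89.B11SchwarzRemainder
import Literature.Analysis.Calculus.ExpLocalLieSubalgebra

/-!
# Bałaban's renormalization group for 4-d lattice Yang–Mills — B7 §A (28), (36)–(41): the second-order Taylor
structure of `log e^{uX}e^{Y}` and the printed constant `24` of (38) (`B7Eq38Remainder`)

CITATION HEADER (lean-in-tree rule 2026-08-18).  Audit cell `pub-balaban`, paper sub-cell B07 (unit b2b-balaban-b07,
gen 8; v1.1 gen 9, see the end of this header).  Source: T. Bałaban, *Averaging operations for lattice gauge theories*, Commun. Math. Phys. **98**, 17–51 (1985)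
[Balaban1985Averaging] (cell paper B7; journal page = PDF page + 16), §A pp. 22–23 [PDF 6–7], quoted from the page
renders `b2b-balaban-ref1/pages/1985-cmp98-averaging/1985-cmp98-averaging-p006-x2.png`, `…-p007-x2.png` READ AS IMAGES.
Companion of `MatrixLog` ((21)–(27): `log` = the series (21) `MatrixLog.mlog`), `B7BlockAvgLog` (`mlog_exp`:
`log e^C = C` for `‖C‖ < ln 2`) and of the one-variable engine `B11SchwarzRemainder` §§1–3 (order-`n` Schwarz lemma /
Cauchy-type remainder bounds for Banach-valued holomorphic functions of one complex variable; only its paper-independent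
§§1–3 are used here); `e^{Y}e^{−Y} = 1` is the tree's `Literature.Analysis.Calculus.exp_mul_exp_neg` (`ExpLocalLieSubalgebra`).
Reference [7] of the paper = V. S. Varadarajan, *Lie groups, Lie algebras, and their
representations*, Prentice-Hall 1974 (Thm. 2.14.3 = the differential of `exp`, (32) below).

THE PRINTED TEXT.  p. 22: "Let us define `Z(u, v) = log e^{uX}e^{vY}`. (28) It is a well-defined and analytic function
of `uX`, `vY`, for example, in the domain `|uX| < ⅛`, `|vY| < ⅛`." … "Let us start with the following basic formula (see
[7, Theorem 2.14.3]) `e^{−A(t)} (d/dt) e^{A(t)} = Σ_{n=0}^∞ ((−1)^n/(n+1)!) (ad_{A(t)})^n A′(t) = g(ad_{A(t)}) A′(t)`, (32)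
where `A(t)` is a differentiable matrix-valued function of `t`. The function `g(z)` defined by the above formula is an
entire function given by `g(z) = Σ_{n=0}^∞ ((−1)^n/(n+1)!) z^n = (e^{−z} − 1)/(−z)` for `z ≠ 0`, `g(0) = 1`, (33)".
p. 23: "hence the function `g^{−1}(z) = 1/g(z)` is an analytic function in a neighborhood of 0, more exactly for
`z ≠ 2kπi`, `k = ±1, ±2, …`, and we have the identities `g^{−1}(z) = −z/(e^{−z} − 1)`, `g^{−1}(−z) = g^{−1}(z) − z`,
`g^{−1}(z) = 1 + ½z + …`. (34) Defining `f(z) = g^{−1}(z) − ½z`, we have `f(−z) = f(z)`, so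
`f(z) = 1 + Σ_{p=1}^∞ k_{2p} z^{2p}`, `g^{−1}(z) = f(z) + ½z`, `g^{−1}(−z) = f(z) − ½z`. (35) Using (32) we can derive
easily the following formulas: `∂Z(u,v)/∂u = g^{−1}(−ad_{Z(u,v)})X`, `∂Z(u,v)/∂v = g^{−1}(ad_{Z(u,v)})Y`. (36) We apply
them to derive the second-order Taylor expansion of `Z(u, v)` with respect to the variable `u`, for example:
`Z(u,v) = Z(0,v) + u ∂Z(0,v)/∂u + u² ∫₀¹ dt (1 − t) ∂²Z(tu,v)/∂u²`, `Z(0,v) = vY`,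
`∂Z(0,v)/∂u = g^{−1}(−ad_{vY})X = g^{−1}(−v ad_Y)X`. (37) From this we get
`(1/i) log e^{iX}e^{iY} = Y + g^{−1}(−i ad_Y)X + 𝓕(X; Y)`, `|𝓕(X; Y)| ≤ O(1)|X|²` (38) for `|X|`, `|Y|` sufficiently
small, where `O(1)` is an absolute constant [e.g., we can take `O(1) = 24` for `|X| ≤ 1/20`, `|Y| ≤ 1/12`]. Another
important function we will need later is `Z(u) = log e^{uX+Y}e^{−Y}`. (39) Repeating the above calculations, we get
`Z(u) = u g(−ad_Y)X + u² ∫₀¹ dt (1 − t) Z″(tu)`, (40) and `(1/i) log e^{iX+iY}e^{−iY} = g(−i ad_Y)X + O(|X|²)`. (41)"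
Here `|·|` is the operator norm (19) p. 21 (`MatrixNorms`); `log` is the series (21) for `|X − 1| < 1` (`MatrixLog.mlog`).

WHAT IS REPRODUCED (all kernel-proved; axioms `propext`/`Classical.choice`/`Quot.sound`).  Everything is stated in an
arbitrary complete normed `ℂ`-algebra `𝔸` (`[NormedRing 𝔸] [NormedAlgebra ℂ 𝔸] [CompleteSpace 𝔸]`), hence for `M_N(ℂ)`
with the operator norm (19) under the scope `Matrix.Norms.L2Operator`, exactly as `MatrixLog` reads (21), (26), (27).
The second variable `v` of (28) is absorbed into `Y` (`Z(u, v) = Z28 X (v • Y) u`); (37)–(38) are statements at `v = 1`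
resp. after `X, Y ↦ iX, iY`.
* `Z28 X Y u = log (e^{uX} e^{Y})` (28) and `Z39 X Y u = log (e^{uX+Y} e^{−Y})` (39), `u ∈ ℂ`;
  `Z28_zero` (`Z(0) = Y` for `‖Y‖ < ln 2`, the clause "`Z(0,v) = vY`" of (37), by `B7BlockAvgLog.mlog_exp`), `Z39_zero`
  (`Z(0) = log 1 = 0`).
* "well-defined and analytic" (p. 22) with an explicit radius: for `‖Y‖ ≤ 1/12` the functions `Z28 X Y`, `Z39 X Y` are
  holomorphic on the disc `|u|·‖X‖ < 1/3` (`differentiableOn_Z28`, `differentiableOn_Z39`; radius bookkeeping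
  `‖e^{uX}e^{Y} − 1‖ ≤ e^{|u|‖X‖+‖Y‖} − 1 ≤ e^{5/12} − 1 ≤ 13/25 < 1`, resp. `e^{1/2} − 1 ≤ 13/20 < 1`, so the series (21)
  applies; `norm_exp_mul_exp_sub_one_le`, `exp_five_twelfths_le`, `exp_half_le`).  v1.1 (§6): ON THE PRINTED DOMAIN ITSELF —
  `Z2 X Y (u, v) = log e^{uX}e^{vY}` is jointly holomorphic in `(u, v) ∈ ℂ²` on `dom28 X Y = {|u|·‖X‖ < ⅛, |v|·‖Y‖ < ⅛}`
  (`differentiableOn_Z2`; there `‖e^{uX}e^{vY} − 1‖ < e^{1/4} − 1 ≤ 3/10`, `exp_quarter_le`), `log` inverts `exp` there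
  (`exp_Z2`), and the `u`-slices are holomorphic on `{|u|·‖X‖ < ⅛}` (`differentiableOn_Z28_printed`).
* THE SECOND-ORDER TAYLOR STRUCTURE (37) WITH THE PRINTED CONSTANT OF (38): writing `D := ∂Z/∂u(0)` (the complex
  derivative `deriv (Z28 X Y) 0`) and `𝓕 := Z(1) − Z(0) − D`,
  `norm_remainder38_le`: `‖Z28 X Y 1 − Y − deriv (Z28 X Y) 0‖ ≤ 21‖X‖²` for `‖X‖ < 1/3`, `‖Y‖ ≤ 1/12`;
  in the printed form (38) (`X, Y ↦ iX, iY`, prefactor `1/i`): `eq38_identity`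
  (`(1/i) log e^{iX}e^{iY} = Y + D36 X Y + F38 X Y`, an algebraic identity with `D36 X Y := (1/i)·∂_u log e^{iuX}e^{iY}|₀`
  and `F38 X Y := (1/i)𝓕(iX; iY)`), `norm_F38_le` (`‖F38 X Y‖ ≤ 21‖X‖²` for `‖X‖ < 1/3`, `‖Y‖ ≤ 1/12`) and
  **`eq38_printed`**: for `‖X‖ ≤ 1/20`, `‖Y‖ ≤ 1/12`, the identity together with `‖F38 X Y‖ ≤ 24‖X‖²` — the printed
  "we can take `O(1) = 24` for `|X| ≤ 1/20`, `|Y| ≤ 1/12`", kernel-checked (with `21` in place of `24`, and on the larger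
  domain `|X| < 1/3`).  Method: the Cauchy/Schwarz estimate for the holomorphic `𝔸`-valued function `u ↦ Z(u) − Z(0)` on the
  disc `|u| < 1/(3‖X‖)` (`norm_taylor_two_remainder_le`, from `B11SchwarzRemainder.norm_sub_leadCoeff_le_two` with
  `n = 1`): `‖Z(u) − Z(0)‖ ≤ 13/12 + 1/12 = 7/6` there (`‖log W‖ ≤ |W − 1|/(1 − |W − 1|) ≤ (13/25)/(12/25)` — the middle
  member of (26), which print states for `|W − 1| ≤ ½` only; used here at `|W − 1| ≤ 13/25` as the TREE THEOREM
  `MatrixLog.norm_mlog_le_div`, valid on the whole disc `|W − 1| < 1` of the series (21) — not as a quotation), whence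
  `‖𝓕‖ ≤ 2·(7/6)·(3‖X‖)² = 21‖X‖²`.  No use is made of the BCH series (29) or of (30)–(31).
* THE LINEAR TERMS, CHARACTERISED BY THE DIFFERENTIAL OF `exp` (the content of (36)/(37) and (40) at `u = 0` that does
  not need the operator calculus `f(ad_X)`): `hasDerivAt_Z28` / `hasDerivAt_Z39` (the derivative at `0` exists), and
  `fderiv_exp_deriv_Z28`: `D exp_Y (∂_u Z28(0)) = X e^{Y}` (differentiate `e^{Z(u)} = e^{uX}e^{Y}` at `u = 0`: chain rule
  + uniqueness of derivatives), `deriv_Z39_eq`: `∂_u Z39(0) = D exp_Y (X) · e^{−Y}` (same for `e^{Z(u)} = e^{uX+Y}e^{−Y}`,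
  using `D exp_0 = id`).  With [7, Thm. 2.14.3] = (32) (`D exp_Y(h) = e^{Y} g(ad_Y) h`) and the identity
  `e^{ad_Y} g(ad_Y) = g(−ad_Y)` these say `g(−ad_Y)(∂_u Z28(0)) = X`, i.e. `∂_u Z28(0) = g^{−1}(−ad_Y)X` (37), and
  `∂_u Z39(0) = g(−ad_Y)X` (40).  v1.1 (§6): BOTH CLAUSES OF (36) AT EVERY POINT of the printed domain, in the same form —
  `fderiv_exp_partial_fst_Z2`: `D exp_{Z(u,v)} (∂Z/∂u) = X e^{Z(u,v)}` and `fderiv_exp_partial_snd_Z2`: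
  `D exp_{Z(u,v)} (∂Z/∂v) = e^{Z(u,v)} Y` (differentiate `e^{Z(u,v)} = e^{uX}e^{vY}`); with (32) these read
  `∂Z/∂u = g^{−1}(−ad_{Z(u,v)})X`, `∂Z/∂v = g^{−1}(ad_{Z(u,v)})Y` = (36) (the inversion of `g(±ad_Z)` is [7] + (33)–(34)).
* (41) with an explicit constant where print has `O(|X|²)`: `norm_remainder41_le` (`‖Z39 X Y 1 − deriv (Z39 X Y) 0‖ ≤ 34‖X‖²`
  for `‖X‖ < 1/3`, `‖Y‖ ≤ 1/12`) and `eq41_printed` (`(1/i) log e^{iX+iY}e^{−iY} = G40 X Y + R41 X Y`, `‖R41 X Y‖ ≤ 34‖X‖²`,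
  `G40 X Y := (1/i)·∂_u log e^{iuX+iY}e^{−iY}|₀`, print: `g(−i ad_Y)X`).

WHAT IS NOT REPRODUCED (scope, recorded in the cell's GAPS.md N-B7-1 / C-B7-A).  (i) The closed forms of the linear terms,
`∂_u Z(0) = g^{−1}(−ad_Y)X` (36)–(37) and `g(−ad_Y)X` (40), i.e. the operator calculus `f(ad_X)` of p. 22 together with
[7, Thm. 2.14.3] (32) and the elementary identities (33)–(35): the tree types neither `ad` as a bounded operator with its
holomorphic functional calculus nor the Bernoulli-number series `g^{−1}`; the linear terms enter here as the derivatives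
`D36`, `G40` characterised by `fderiv_exp_deriv_Z28` / `deriv_Z39_eq`, and their identification with the printed closed
forms is the PUBLISHED theorem [7, Thm. 2.14.3] plus (33)–(35) (cite leaf; lineage verdict gens 1–7: "typable only with a
matrix-BCH library").  (ii) The BCH series (29) and the bounds (30)–(31) (unspecified constants `c₀`, `c₁`, `O(1)`).
(iii) The integral form of the remainder in (37)/(40) (`u² ∫₀¹ (1 − t) ∂²_u Z(tu) dt`): the remainder is handled directly as
`Z(1) − Z(0) − ∂_u Z(0)` by the Cauchy estimate, which is all (38)/(41) assert.

FINDINGS OF THE AUDIT (cell GAPS.md N-B7-1, upgraded by this module from NUMERICAL to NUMERICAL + KERNEL).  The printed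
constant holds with room to spare: KERNEL `‖𝓕(X; Y)‖ ≤ 21|X|²` on `|X| < 1/3`, `|Y| ≤ 1/12` (this file; the Cauchy estimate
is not optimised — radius `1/3` and the second member of (26) are chosen so that all numerics are the two rational facts
`e^{5/12} ≤ 38/25`, `e^{1/2} ≤ 33/20`); NUMERICALLY the sharp majorant-series constant is `≤ 1.382` (cell file
`b2b-balaban-b07/num/bch38.py`, three engines, 2026-08-18).  Print: `24`.  No objection.
Value = kernel certificate of the one numerically explicit constant of [Balaban1985Averaging] and of the Taylor bookkeeping
(37)/(40) in the vocabulary (21); NOT summit progress.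

v1.1 (unit b2b-balaban-b07 gen 9, 2026-08-19).  (a) DOCFIX for the cross-read objection G-adv9-63 (cell GAPS.md; adversarial
reader adv9-g25, certificate `b2b-balaban-adv9/g25/XREAD-B7Eq38Remainder.md`): print states (26) «For matrices `X` satisfying
`|X − 1| ≤ ½`, we have `|log X| ≤ Σ_{n≥1} (1/n)|X − 1|^n ≤ |X − 1|/(1 − |X − 1|) ≤ 2|X − 1|`» (p. 22); v1's docstrings of
`norm_Z28_le` / `norm_Z39_le` and one header clause cited «(26)» at `|W − 1| ≤ 13/25`, `13/20` (> ½).  The inequality used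
there is the middle member of (26) on the full disc `|W − 1| < 1` of the series (21), which is a tree THEOREM
(`MatrixLog.norm_mlog_le_div`), not a quotation; the wording now says so.  No declaration of v1 changed (the v1 declaration
region is byte-identical).  (b) APPEND-ONLY §6: the PRINTED analyticity domain of (28), «`|uX| < ⅛`, `|vY| < ⅛`», typed as
joint holomorphy of `(u, v) ↦ log e^{uX}e^{vY}` on that domain, and both clauses of (36) characterised there by the
differential of `exp` (v1 had them at `u = 0` only, on the working radii `1/3`, `1/12`).
-/

noncomputable section

open NormedSpace Set Filter Topology Metric
open Complex (I I_ne_zero)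

namespace Literature.MathematicalPhysics.QuantumFieldTheory.Balaban1983to89.B7Eq38Remainder

open MatrixLog B7BlockAvgLog B11SchwarzRemainder
open Literature.Analysis.Complex (logOnePlus)

/-! ## §0  The two rational exponential bounds used for the radii -/

/-- `e^x ≤ 1 + x + x²/2 + x³/6 + 5x⁴/96` for `0 ≤ x ≤ 1` (Mathlib `Real.exp_bound'`, four terms). [folklore] -/
theorem exp_le_quartic {x : ℝ} (h0 : 0 ≤ x) (h1 : x ≤ 1) :
    Real.exp x ≤ 1 + x + x ^ 2 / 2 + x ^ 3 / 6 + 5 * x ^ 4 / 96 := by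
  have h := Real.exp_bound' h0 h1 (n := 4) (by norm_num)
  have hs : ∑ m ∈ Finset.range 4, x ^ m / (m.factorial : ℝ) = 1 + x + x ^ 2 / 2 + x ^ 3 / 6 := by
    simp only [Finset.sum_range_succ, Finset.sum_range_zero, Nat.factorial, Nat.succ_eq_add_one]
    norm_num
  rw [hs] at h
  have h4 : (Nat.factorial 4 : ℝ) = 24 := by norm_num [Nat.factorial]
  rw [h4] at h
  have : x ^ 4 * ((4 : ℕ) + 1 : ℝ) / (24 * (4 : ℕ)) = 5 * x ^ 4 / 96 := by push_cast; ring
  linarith [this]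

/-- `e^{5/12} ≤ 38/25` (`e^{5/12} = 1.5169…`): the radius bookkeeping of (28)/(38) at `|uX| ≤ 1/3`, `|Y| ≤ 1/12`.
[folklore] -/
theorem exp_five_twelfths_le : Real.exp (5 / 12) ≤ 38 / 25 := by
  have h := exp_le_quartic (x := 5 / 12) (by norm_num) (by norm_num)
  have h2 : (1 : ℝ) + 5 / 12 + (5 / 12) ^ 2 / 2 + (5 / 12) ^ 3 / 6 + 5 * (5 / 12) ^ 4 / 96 ≤ 38 / 25 := by norm_num
  exact h.trans h2

/-- `e^{1/2} ≤ 33/20` (`e^{1/2} = 1.6487…`): the radius bookkeeping of (39)/(41) at `|uX| ≤ 1/3`, `|Y| ≤ 1/12`.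
[folklore] -/
theorem exp_half_le : Real.exp (1 / 2) ≤ 33 / 20 := by
  have h := exp_le_quartic (x := 1 / 2) (by norm_num) (by norm_num)
  have h2 : (1 : ℝ) + 1 / 2 + (1 / 2) ^ 2 / 2 + (1 / 2) ^ 3 / 6 + 5 * (1 / 2) ^ 4 / 96 ≤ 33 / 20 := by norm_num
  exact h.trans h2

/-- Monotonicity of the second majorant of (26): `w ≤ τ < 1 ⟹ w/(1 − w) ≤ τ/(1 − τ)`. [folklore] -/
theorem div_one_sub_mono {w τ : ℝ} (hw : w ≤ τ) (hτ : τ < 1) :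
    w / (1 - w) ≤ τ / (1 - τ) := by
  have h1 : 0 < 1 - w := by linarith
  have h2 : 0 < 1 - τ := by linarith
  rw [div_le_div_iff₀ h1 h2]
  nlinarith

/-! ## §1  One complex variable: the second-order Taylor remainder of a holomorphic Banach-valued function on a disc -/

section Disc

variable {E : Type*} [NormedAddCommGroup E] [NormedSpace ℂ E] [CompleteSpace E]

/-- CAUCHY/SCHWARZ ESTIMATE OF THE SECOND-ORDER TAYLOR REMAINDER.  If `f` is holomorphic on `|t| < ρ` with
`‖f(t) − f(0)‖ ≤ B` there, then `‖f(t) − f(0) − t f′(0)‖ ≤ 2B(|t|/ρ)²` on the disc (the tree's order-`n` Schwarz lemma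
`B11SchwarzRemainder.norm_sub_leadCoeff_le_two` at `n = 1` applied to `f − f(0)`).  This replaces the integral form of the
remainder in (37)/(40). [folklore] -/
theorem norm_taylor_two_remainder_le {f : ℂ → E} {ρ B : ℝ} (hd : DifferentiableOn ℂ f (ball 0 ρ))
    (hB : ∀ t ∈ ball (0 : ℂ) ρ, ‖f t - f 0‖ ≤ B) {t : ℂ} (ht : t ∈ ball (0 : ℂ) ρ) :
    ‖f t - f 0 - t • deriv f 0‖ ≤ 2 * B * (‖t‖ / ρ) ^ 2 := by
  have hρ : 0 < ρ := lt_of_le_of_lt (norm_nonneg t) (mem_ball_zero_iff.mp ht)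
  set g : ℂ → E := fun s => f s - f 0 with hg
  have hgd : DifferentiableOn ℂ g (ball 0 ρ) := hd.sub_const (f 0)
  have hg0 : g 0 = 0 := by simp [hg]
  have hgO : OrderGe g 1 := by
    have hda : DifferentiableAt ℂ g 0 := hgd.differentiableAt (ball_mem_nhds _ hρ)
    have hcont : ContinuousAt (dslope g 0) 0 := continuousAt_dslope_same.mpr hda
    refine OrderGe.of_eq_pow_smul hcont fun s => ?_
    have h := sub_smul_dslope g 0 s
    rw [sub_zero, hg0, sub_zero] at h
    rw [pow_one, h]
  have h := norm_sub_leadCoeff_le_two hgd hB hgO ht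
  have hlead : leadCoeff g 1 = deriv f 0 := by
    rw [leadCoeff_one]
    exact deriv_sub_const (f 0)
  rw [hlead, pow_one] at h
  simpa [hg, sub_sub] using h

end Disc

/-! ## §2  The functions (28) and (39) in a complete normed `ℂ`-algebra -/

section Algebra

variable {𝔸 : Type*} [NormedRing 𝔸] [NormedAlgebra ℂ 𝔸] [CompleteSpace 𝔸]

/-- Radius bookkeeping: `‖e^a e^b − 1‖ ≤ e^{‖a‖+‖b‖} − 1`, from `e^a e^b − 1 = (e^a − 1)(e^b − 1) + (e^a − 1) + (e^b − 1)`
and the tree's `‖e^a − 1‖ ≤ e^{‖a‖} − 1` (`Literature.Analysis.Calculus.norm_exp_sub_one_le`). [folklore] -/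
theorem norm_exp_mul_exp_sub_one_le (a b : 𝔸) :
    ‖exp a * exp b - 1‖ ≤ Real.exp (‖a‖ + ‖b‖) - 1 := by
  have ha := Literature.Analysis.Calculus.norm_exp_sub_one_le a
  have hb := Literature.Analysis.Calculus.norm_exp_sub_one_le b
  have h0a : 0 ≤ Real.exp ‖a‖ - 1 := by linarith [Real.add_one_le_exp ‖a‖, norm_nonneg a]
  have hid : exp a * exp b - 1 = (exp a - 1) * (exp b - 1) + ((exp a - 1) + (exp b - 1)) := by noncomm_ring
  rw [hid, Real.exp_add]
  calc ‖(exp a - 1) * (exp b - 1) + ((exp a - 1) + (exp b - 1))‖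
      ≤ ‖(exp a - 1) * (exp b - 1)‖ + (‖exp a - 1‖ + ‖exp b - 1‖) :=
        (norm_add_le _ _).trans (add_le_add le_rfl (norm_add_le _ _))
    _ ≤ (Real.exp ‖a‖ - 1) * (Real.exp ‖b‖ - 1) + ((Real.exp ‖a‖ - 1) + (Real.exp ‖b‖ - 1)) := by
        gcongr
        exact (norm_mul_le _ _).trans (mul_le_mul ha hb (norm_nonneg _) h0a)
    _ = Real.exp ‖a‖ * Real.exp ‖b‖ - 1 := by ring

omit [CompleteSpace 𝔸] in
/-- `‖I • a‖ = ‖a‖`. [folklore] -/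
theorem norm_I_smul' (a : 𝔸) : ‖(I • a : 𝔸)‖ = ‖a‖ := by
  rw [norm_smul, Complex.norm_I, one_mul]

/-- `1/12 < ln 2`, so `log e^{Y} = Y` (`B7BlockAvgLog.mlog_exp`) applies at `|Y| ≤ 1/12`. [folklore] -/
theorem lt_log_two_of_le_twelfth {y : ℝ} (hy : y ≤ 1 / 12) : y < Real.log 2 :=
  lt_of_le_of_lt hy (lt_trans (by norm_num) Real.log_two_gt_d9)

/-- **(28)** p. 22: `Z(u) := log e^{uX} e^{Y}` (`u ∈ ℂ`; the printed `Z(u, v) = log e^{uX}e^{vY}` is `Z28 X (v • Y) u`),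
`log` = the series (21) `MatrixLog.mlog`. [cite: Balaban1985Averaging, (28) p.22] -/
def Z28 (X Y : 𝔸) (u : ℂ) : 𝔸 := mlog (exp (u • X) * exp Y)

/-- **(39)** p. 23: `Z(u) := log e^{uX+Y} e^{−Y}` (`u ∈ ℂ`). [cite: Balaban1985Averaging, (39) p.23] -/
def Z39 (X Y : 𝔸) (u : ℂ) : 𝔸 := mlog (exp (u • X + Y) * exp (-Y))

/-- The path under the logarithm of (28), `u ↦ e^{uX}e^{Y}`, is entire with derivative `e^{uX} X e^{Y}`. [folklore] -/
theorem hasDerivAt_exp_smul_mul_exp (X Y : 𝔸) (u : ℂ) :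
    HasDerivAt (fun u : ℂ => exp (u • X) * exp Y) (exp (u • X) * X * exp Y) u :=
  (hasDerivAt_exp_smul_const (𝕂 := ℂ) X u).mul_const (exp Y)

/-- The path under the logarithm of (39), `u ↦ e^{uX+Y}e^{−Y}`, has derivative `D exp_{uX+Y}(X) · e^{−Y}`. [folklore] -/
theorem hasDerivAt_exp_add_mul_exp_neg (X Y : 𝔸) (u : ℂ) :
    HasDerivAt (fun u : ℂ => exp (u • X + Y) * exp (-Y)) (fderiv ℂ exp (u • X + Y) X * exp (-Y)) u := by
  have hl : HasDerivAt (fun u : ℂ => u • X + Y) X u := by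
    simpa using ((hasDerivAt_id u).smul_const X).add_const Y
  have he : HasFDerivAt (exp : 𝔸 → 𝔸) (fderiv ℂ exp (u • X + Y)) (u • X + Y) :=
    (exp_analytic (𝕂 := ℂ) (u • X + Y)).differentiableAt.hasFDerivAt
  have h := he.comp_hasDerivAt u hl
  exact h.mul_const (exp (-Y))

/-- "`Z(0, v) = vY`" of (37): `Z28 X Y 0 = log e^{Y} = Y` for `‖Y‖ < ln 2` (`B7BlockAvgLog.mlog_exp`).
[cite: Balaban1985Averaging, (37) p.23] -/
theorem Z28_zero (X : 𝔸) {Y : 𝔸} (hY : ‖Y‖ < Real.log 2) : Z28 X Y 0 = Y := by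
  simp only [Z28, zero_smul, exp_zero, one_mul]
  exact mlog_exp hY

/-- `Z39 X Y 0 = log (e^{Y}e^{−Y}) = log 1 = 0` (`e^{Y}e^{−Y} = 1`: the tree's `Literature.Analysis.Calculus.exp_mul_exp_neg`).
[cite: Balaban1985Averaging, (39)–(40) p.23] -/
theorem Z39_zero (X Y : 𝔸) : Z39 X Y 0 = 0 := by
  simp only [Z39, zero_smul, zero_add, Literature.Analysis.Calculus.exp_mul_exp_neg, mlog_one]

/-- Radius bookkeeping for (28): `|uX| ≤ 1/3`, `|Y| ≤ 1/12 ⟹ ‖e^{uX}e^{Y} − 1‖ ≤ e^{5/12} − 1 ≤ 13/25`. [folklore] -/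
theorem norm_arg28_sub_one_le {X Y : 𝔸} {u : ℂ} (hu : ‖u‖ * ‖X‖ ≤ 1 / 3) (hY : ‖Y‖ ≤ 1 / 12) :
    ‖exp (u • X) * exp Y - 1‖ ≤ 13 / 25 := by
  have h1 := norm_exp_mul_exp_sub_one_le (u • X) Y
  have h2 : ‖u • X‖ + ‖Y‖ ≤ 5 / 12 := by rw [norm_smul]; linarith
  have h3 : Real.exp (‖u • X‖ + ‖Y‖) ≤ Real.exp (5 / 12) := Real.exp_le_exp.mpr h2
  linarith [exp_five_twelfths_le]

/-- Radius bookkeeping for (39): `|uX| ≤ 1/3`, `|Y| ≤ 1/12 ⟹ ‖e^{uX+Y}e^{−Y} − 1‖ ≤ e^{1/2} − 1 ≤ 13/20`. [folklore] -/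
theorem norm_arg39_sub_one_le {X Y : 𝔸} {u : ℂ} (hu : ‖u‖ * ‖X‖ ≤ 1 / 3) (hY : ‖Y‖ ≤ 1 / 12) :
    ‖exp (u • X + Y) * exp (-Y) - 1‖ ≤ 13 / 20 := by
  have h1 := norm_exp_mul_exp_sub_one_le (u • X + Y) (-Y)
  have h2 : ‖u • X + Y‖ + ‖-Y‖ ≤ 1 / 2 := by
    have := norm_add_le (u • X) Y
    rw [norm_smul] at this
    rw [norm_neg]
    linarith
  have h3 : Real.exp (‖u • X + Y‖ + ‖-Y‖) ≤ Real.exp (1 / 2) := Real.exp_le_exp.mpr h2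
  linarith [exp_half_le]

/-- `‖Z28 X Y u‖ ≤ (13/25)/(12/25) = 13/12` for `|uX| ≤ 1/3`, `|Y| ≤ 1/12`: the middle member of (26),
`‖log W‖ ≤ |W − 1|/(1 − |W − 1|)`, extended from the printed `|W − 1| ≤ ½` (p. 22) to the whole disc `|W − 1| < 1` of the
series (21) — a tree theorem (`MatrixLog.norm_mlog_le_div`), applied at `|W − 1| ≤ 13/25`; not a quotation of (26)
(v1.1 wording, G-adv9-63). [cite: Balaban1985Averaging, (21), (26) p.22] -/
theorem norm_Z28_le {X Y : 𝔸} {u : ℂ} (hu : ‖u‖ * ‖X‖ ≤ 1 / 3) (hY : ‖Y‖ ≤ 1 / 12) :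
    ‖Z28 X Y u‖ ≤ 13 / 12 := by
  have hw := norm_arg28_sub_one_le hu hY
  have hw1 : ‖exp (u • X) * exp Y - 1‖ < 1 := hw.trans_lt (by norm_num)
  have h := norm_mlog_le_div hw1
  have hm := div_one_sub_mono hw (show (13 / 25 : ℝ) < 1 by norm_num)
  have : (13 / 25 : ℝ) / (1 - 13 / 25) = 13 / 12 := by norm_num
  rw [this] at hm
  exact h.trans hm

/-- `‖Z39 X Y u‖ ≤ (13/20)/(7/20) = 13/7` for `|uX| ≤ 1/3`, `|Y| ≤ 1/12`: the middle member of (26) extended from the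
printed `|W − 1| ≤ ½` to `|W − 1| < 1` by the series (21) (tree theorem `MatrixLog.norm_mlog_le_div`, applied at
`|W − 1| ≤ 13/20`; not a quotation of (26) — v1.1 wording, G-adv9-63). [cite: Balaban1985Averaging, (21), (26) p.22] -/
theorem norm_Z39_le {X Y : 𝔸} {u : ℂ} (hu : ‖u‖ * ‖X‖ ≤ 1 / 3) (hY : ‖Y‖ ≤ 1 / 12) :
    ‖Z39 X Y u‖ ≤ 13 / 7 := by
  have hw := norm_arg39_sub_one_le hu hY
  have hw1 : ‖exp (u • X + Y) * exp (-Y) - 1‖ < 1 := hw.trans_lt (by norm_num)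
  have h := norm_mlog_le_div hw1
  have hm := div_one_sub_mono hw (show (13 / 20 : ℝ) < 1 by norm_num)
  have : (13 / 20 : ℝ) / (1 - 13 / 20) = 13 / 7 := by norm_num
  rw [this] at hm
  exact h.trans hm

omit [NormedAlgebra ℂ 𝔸] [CompleteSpace 𝔸] in
/-- In the disc `|u| < ρ` with `ρ‖X‖ ≤ 1/3` one has `|u|·‖X‖ ≤ 1/3`. [folklore] -/
theorem norm_mul_le_third_of_mem_ball {X : 𝔸} {ρ : ℝ} (hρ : ρ * ‖X‖ ≤ 1 / 3) {u : ℂ} (hu : u ∈ ball (0 : ℂ) ρ) :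
    ‖u‖ * ‖X‖ ≤ 1 / 3 :=
  (mul_le_mul_of_nonneg_right (mem_ball_zero_iff.mp hu).le (norm_nonneg X)).trans hρ

/-- "It is a well-defined and analytic function" (p. 22), with a radius: for `|Y| ≤ 1/12`, `u ↦ Z28 X Y u` is
holomorphic on every disc `|u| < ρ` with `ρ‖X‖ ≤ 1/3` (there `‖e^{uX}e^{Y} − 1‖ ≤ 13/25 < 1`, inside the domain of the
series (21); `Literature.Analysis.Complex.differentiableOn_logOnePlus_comp`). [cite: Balaban1985Averaging, (28) p.22] -/
theorem differentiableOn_Z28 (X : 𝔸) {Y : 𝔸} (hY : ‖Y‖ ≤ 1 / 12) {ρ : ℝ} (hρ : ρ * ‖X‖ ≤ 1 / 3) :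
    DifferentiableOn ℂ (Z28 X Y) (ball 0 ρ) := by
  have hW : DifferentiableOn ℂ (fun u : ℂ => exp (u • X) * exp Y - 1) (ball 0 ρ) := fun u _ =>
    ((hasDerivAt_exp_smul_mul_exp X Y u).differentiableAt.sub_const 1).differentiableWithinAt
  have h1 : ∀ u ∈ ball (0 : ℂ) ρ, ‖exp (u • X) * exp Y - 1‖ < 1 := fun u hu =>
    (norm_arg28_sub_one_le (norm_mul_le_third_of_mem_ball hρ hu) hY).trans_lt (by norm_num)
  exact Literature.Analysis.Complex.differentiableOn_logOnePlus_comp hW h1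

/-- The same for (39): `u ↦ Z39 X Y u` is holomorphic on `|u| < ρ` whenever `ρ‖X‖ ≤ 1/3`, `|Y| ≤ 1/12`.
[cite: Balaban1985Averaging, (39) p.23] -/
theorem differentiableOn_Z39 (X : 𝔸) {Y : 𝔸} (hY : ‖Y‖ ≤ 1 / 12) {ρ : ℝ} (hρ : ρ * ‖X‖ ≤ 1 / 3) :
    DifferentiableOn ℂ (Z39 X Y) (ball 0 ρ) := by
  have hW : DifferentiableOn ℂ (fun u : ℂ => exp (u • X + Y) * exp (-Y) - 1) (ball 0 ρ) := fun u _ =>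
    ((hasDerivAt_exp_add_mul_exp_neg X Y u).differentiableAt.sub_const 1).differentiableWithinAt
  have h1 : ∀ u ∈ ball (0 : ℂ) ρ, ‖exp (u • X + Y) * exp (-Y) - 1‖ < 1 := fun u hu =>
    (norm_arg39_sub_one_le (norm_mul_le_third_of_mem_ball hρ hu) hY).trans_lt (by norm_num)
  exact Literature.Analysis.Complex.differentiableOn_logOnePlus_comp hW h1

omit [NormedAlgebra ℂ 𝔸] [CompleteSpace 𝔸] in
/-- A disc about `0` on which both functions are holomorphic, for every `X`: radius `ρ₀ = 1/(3(‖X‖ + 1))`. [folklore] -/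
theorem rho0_pos_and_le (X : 𝔸) : 0 < (3 * (‖X‖ + 1))⁻¹ ∧ (3 * (‖X‖ + 1))⁻¹ * ‖X‖ ≤ 1 / 3 := by
  have hX := norm_nonneg X
  have hpos : 0 < 3 * (‖X‖ + 1) := by positivity
  refine ⟨inv_pos.mpr hpos, ?_⟩
  rw [inv_mul_le_iff₀ hpos]
  nlinarith

/-! ## §3  The second-order Taylor structure (37) and the constant of (38) -/

/-- **THE REMAINDER OF (37)/(38), KERNEL FORM.**  For `‖X‖ < 1/3` and `‖Y‖ ≤ 1/12`, with `Z(u) = log e^{uX}e^{Y}` (28):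
`‖Z(1) − Y − Z′(0)‖ ≤ 21‖X‖²` (here `Z(0) = Y`, and `Z′(0)` = `deriv (Z28 X Y) 0` is the linear term of (37), in print
`g^{−1}(−ad_Y)X`).  Proof: Cauchy/Schwarz estimate `norm_taylor_two_remainder_le` on the disc `|u| < 1/(3‖X‖)` with
`‖Z(u) − Z(0)‖ ≤ 13/12 + 1/12 = 7/6`: `2·(7/6)·(3‖X‖)² = 21‖X‖²`. [cite: Balaban1985Averaging, (37)–(38) p.23] -/
theorem norm_remainder38_le {X Y : 𝔸} (hX : ‖X‖ < 1 / 3) (hY : ‖Y‖ ≤ 1 / 12) :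
    ‖Z28 X Y 1 - Y - deriv (Z28 X Y) 0‖ ≤ 21 * ‖X‖ ^ 2 := by
  have hY2 : ‖Y‖ < Real.log 2 := lt_log_two_of_le_twelfth hY
  by_cases hX0 : X = 0
  · subst hX0
    have hc : Z28 (0 : 𝔸) Y = fun _ => Y := by
      funext u
      simp only [Z28, smul_zero, exp_zero, one_mul]
      exact mlog_exp hY2
    rw [hc]
    simp
  · have hXpos : 0 < ‖X‖ := norm_pos_iff.mpr hX0
    set ρ : ℝ := (3 * ‖X‖)⁻¹ with hρdef
    have h3 : 0 < 3 * ‖X‖ := by positivity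
    have hρpos : 0 < ρ := inv_pos.mpr h3
    have hρX : ρ * ‖X‖ ≤ 1 / 3 := by
      rw [hρdef]
      field_simp
      nlinarith
    have h1 : (1 : ℂ) ∈ ball (0 : ℂ) ρ := by
      rw [mem_ball_zero_iff, norm_one, hρdef, lt_inv_comm₀ one_pos h3, inv_one]
      linarith
    have hd := differentiableOn_Z28 X hY hρX
    have hB : ∀ t ∈ ball (0 : ℂ) ρ, ‖Z28 X Y t - Z28 X Y 0‖ ≤ 7 / 6 := by
      intro t ht
      have ht' := norm_Z28_le (norm_mul_le_third_of_mem_ball hρX ht) hY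
      rw [Z28_zero X hY2]
      calc ‖Z28 X Y t - Y‖ ≤ ‖Z28 X Y t‖ + ‖Y‖ := norm_sub_le _ _
        _ ≤ 13 / 12 + 1 / 12 := add_le_add ht' hY
        _ = 7 / 6 := by norm_num
    have h := norm_taylor_two_remainder_le hd hB h1
    rw [Z28_zero X hY2, one_smul, norm_one] at h
    have hρinv : (1 : ℝ) / ρ = 3 * ‖X‖ := by rw [hρdef, one_div, inv_inv]
    rw [hρinv] at h
    calc ‖Z28 X Y 1 - Y - deriv (Z28 X Y) 0‖ ≤ 2 * (7 / 6) * (3 * ‖X‖) ^ 2 := h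
      _ = 21 * ‖X‖ ^ 2 := by ring

/-- **`D36 X Y`** — the linear term of (38): `(1/i) ∂_u log e^{iuX}e^{iY}|_{u=0}` (in print `g^{−1}(−i ad_Y)X`, by (36)/(37)
and [7, Thm. 2.14.3]; characterised here by `fderiv_exp_deriv_Z28`). [cite: Balaban1985Averaging, (38) p.23] -/
def D36 (X Y : 𝔸) : 𝔸 := (I⁻¹ : ℂ) • deriv (Z28 (I • X) (I • Y)) 0

/-- **`F38 X Y = 𝓕(X; Y)`** of (38): `(1/i)(Z(1) − iY − ∂_u Z(0))` for `Z(u) = log e^{iuX}e^{iY}` — the second-order Taylor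
remainder of (37) at `u = 1`. [cite: Balaban1985Averaging, (38) p.23] -/
def F38 (X Y : 𝔸) : 𝔸 := (I⁻¹ : ℂ) • (Z28 (I • X) (I • Y) 1 - I • Y - deriv (Z28 (I • X) (I • Y)) 0)

omit [CompleteSpace 𝔸] in
/-- (38), the identity: `(1/i) log e^{iX}e^{iY} = Y + D36 X Y + F38 X Y` (algebra: `Z28 (iX) (iY) 1 = log e^{iX}e^{iY}`,
`(1/i)(iY) = Y`). [cite: Balaban1985Averaging, (38) p.23] -/
theorem eq38_identity (X Y : 𝔸) :
    (I⁻¹ : ℂ) • mlog (exp (I • X) * exp (I • Y)) = Y + D36 X Y + F38 X Y := by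
  have hZ1 : Z28 (I • X) (I • Y) 1 = mlog (exp (I • X) * exp (I • Y)) := by simp only [Z28, one_smul]
  have hIY : (I⁻¹ : ℂ) • (I • Y) = Y := by rw [smul_smul, inv_mul_cancel₀ I_ne_zero, one_smul]
  simp only [D36, F38, smul_sub, hZ1, hIY]
  abel

/-- (38), the bound, kernel constant: `‖F38 X Y‖ ≤ 21‖X‖²` for `‖X‖ < 1/3`, `‖Y‖ ≤ 1/12` (`norm_remainder38_le` at
`iX`, `iY`; `|iX| = |X|`, `|(1/i)·| = |·|`). [cite: Balaban1985Averaging, (38) p.23] -/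
theorem norm_F38_le {X Y : 𝔸} (hX : ‖X‖ < 1 / 3) (hY : ‖Y‖ ≤ 1 / 12) : ‖F38 X Y‖ ≤ 21 * ‖X‖ ^ 2 := by
  have hX' : ‖(I • X : 𝔸)‖ < 1 / 3 := by rwa [norm_I_smul']
  have hY' : ‖(I • Y : 𝔸)‖ ≤ 1 / 12 := by rwa [norm_I_smul']
  have h := norm_remainder38_le hX' hY'
  rw [norm_I_smul'] at h
  rw [F38, norm_Iinv_smul]
  exact h

/-- **(38) AS PRINTED** (p. 23): for `|X| ≤ 1/20`, `|Y| ≤ 1/12`,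
`(1/i) log e^{iX}e^{iY} = Y + D36 X Y + 𝓕(X; Y)` with `|𝓕(X; Y)| ≤ 24|X|²` — "we can take `O(1) = 24` for `|X| ≤ 1/20`,
`|Y| ≤ 1/12`", kernel-checked (indeed `≤ 21|X|²`, `norm_F38_le`).  The linear term `D36 X Y` is identified with the printed
`g^{−1}(−i ad_Y)X` by [7, Thm. 2.14.3] and (33)–(35) (not typed; see `fderiv_exp_deriv_Z28`).
[cite: Balaban1985Averaging, (38) p.23] -/
theorem eq38_printed {X Y : 𝔸} (hX : ‖X‖ ≤ 1 / 20) (hY : ‖Y‖ ≤ 1 / 12) :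
    (I⁻¹ : ℂ) • mlog (exp (I • X) * exp (I • Y)) = Y + D36 X Y + F38 X Y ∧ ‖F38 X Y‖ ≤ 24 * ‖X‖ ^ 2 := by
  refine ⟨eq38_identity X Y, (norm_F38_le (hX.trans_lt (by norm_num)) hY).trans ?_⟩
  nlinarith [sq_nonneg ‖X‖]

/-! ## §4  The linear terms as solutions of the `exp`-differential equations ((36)/(37), (40) at `u = 0`) -/

/-- `Z28 X Y` is differentiable at `u = 0` (for `|Y| ≤ 1/12`, any `X`): the linear term of (37) exists.
[cite: Balaban1985Averaging, (36)–(37) p.23] -/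
theorem hasDerivAt_Z28 (X : 𝔸) {Y : 𝔸} (hY : ‖Y‖ ≤ 1 / 12) :
    HasDerivAt (Z28 X Y) (deriv (Z28 X Y) 0) 0 := by
  obtain ⟨hρ, hρX⟩ := rho0_pos_and_le X
  exact ((differentiableOn_Z28 X hY hρX).differentiableAt (ball_mem_nhds _ hρ)).hasDerivAt

/-- `Z39 X Y` is differentiable at `u = 0` (for `|Y| ≤ 1/12`, any `X`): the linear term of (40) exists.
[cite: Balaban1985Averaging, (40) p.23] -/
theorem hasDerivAt_Z39 (X : 𝔸) {Y : 𝔸} (hY : ‖Y‖ ≤ 1 / 12) :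
    HasDerivAt (Z39 X Y) (deriv (Z39 X Y) 0) 0 := by
  obtain ⟨hρ, hρX⟩ := rho0_pos_and_le X
  exact ((differentiableOn_Z39 X hY hρX).differentiableAt (ball_mem_nhds _ hρ)).hasDerivAt

/-- `e^{Z28(u)} = e^{uX}e^{Y}` near `u = 0` ("It is an inverse to the exponential function", p. 21: `MatrixLog.exp_mlog` on the
disc). [cite: Balaban1985Averaging, (28) p.22] -/
theorem exp_Z28_eventuallyEq (X : 𝔸) {Y : 𝔸} (hY : ‖Y‖ ≤ 1 / 12) :
    (fun u => exp (Z28 X Y u)) =ᶠ[𝓝 (0 : ℂ)] fun u => exp (u • X) * exp Y := by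
  obtain ⟨hρ, hρX⟩ := rho0_pos_and_le X
  filter_upwards [ball_mem_nhds (0 : ℂ) hρ] with u hu
  exact exp_mlog ((norm_arg28_sub_one_le (norm_mul_le_third_of_mem_ball hρX hu) hY).trans_lt (by norm_num))

/-- `e^{Z39(u)} = e^{uX+Y}e^{−Y}` near `u = 0`. [cite: Balaban1985Averaging, (39) p.23] -/
theorem exp_Z39_eventuallyEq (X : 𝔸) {Y : 𝔸} (hY : ‖Y‖ ≤ 1 / 12) :
    (fun u => exp (Z39 X Y u)) =ᶠ[𝓝 (0 : ℂ)] fun u => exp (u • X + Y) * exp (-Y) := by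
  obtain ⟨hρ, hρX⟩ := rho0_pos_and_le X
  filter_upwards [ball_mem_nhds (0 : ℂ) hρ] with u hu
  exact exp_mlog ((norm_arg39_sub_one_le (norm_mul_le_third_of_mem_ball hρX hu) hY).trans_lt (by norm_num))

/-- **THE LINEAR TERM OF (37), CHARACTERISED.**  For `|Y| ≤ 1/12` the derivative `D = ∂_u Z28(0)` satisfies
`D exp_Y (D) = X e^{Y}` — differentiate `e^{Z(u)} = e^{uX}e^{Y}` at `u = 0` (chain rule through the Fréchet derivative of
`exp` at `Z(0) = Y`, uniqueness of derivatives).  With [7, Thm. 2.14.3] = (32), `D exp_Y(h) = e^{Y} g(ad_Y) h`, and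
`e^{ad_Y} g(ad_Y) = g(−ad_Y)`, this reads `g(−ad_Y) D = X`, i.e. the printed `∂Z(0,v)/∂u = g^{−1}(−ad_{vY})X` (37) / (36).
[cite: Balaban1985Averaging, (36)–(37) p.23] -/
theorem fderiv_exp_deriv_Z28 (X : 𝔸) {Y : 𝔸} (hY : ‖Y‖ ≤ 1 / 12) :
    fderiv ℂ exp Y (deriv (Z28 X Y) 0) = X * exp Y := by
  have hY2 : ‖Y‖ < Real.log 2 := lt_log_two_of_le_twelfth hY
  have hZ := hasDerivAt_Z28 X hY
  have hZ0 : Z28 X Y 0 = Y := Z28_zero X hY2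
  have he : HasFDerivAt (exp : 𝔸 → 𝔸) (fderiv ℂ exp (Z28 X Y 0)) (Z28 X Y 0) :=
    (exp_analytic (𝕂 := ℂ) (Z28 X Y 0)).differentiableAt.hasFDerivAt
  have h1 : HasDerivAt (fun u => exp (Z28 X Y u)) (fderiv ℂ exp (Z28 X Y 0) (deriv (Z28 X Y) 0)) 0 :=
    he.comp_hasDerivAt (0 : ℂ) hZ
  have h2 : HasDerivAt (fun u => exp (Z28 X Y u)) (exp ((0 : ℂ) • X) * X * exp Y) 0 :=
    (hasDerivAt_exp_smul_mul_exp X Y 0).congr_of_eventuallyEq (exp_Z28_eventuallyEq X hY)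
  have h := h1.unique h2
  rw [hZ0, zero_smul, exp_zero, one_mul] at h
  exact h

/-- **THE LINEAR TERM OF (40), CHARACTERISED.**  For `|Y| ≤ 1/12`: `∂_u Z39(0) = D exp_Y (X) · e^{−Y}` — differentiate
`e^{Z(u)} = e^{uX+Y}e^{−Y}` at `u = 0`, where `Z(0) = 0` and `D exp_0 = id` (Mathlib `hasFDerivAt_exp_zero`).  With
[7, Thm. 2.14.3] = (32), `D exp_Y(X) e^{−Y} = e^{Y} g(ad_Y)(X) e^{−Y} = g(−ad_Y)X`, the printed linear term of (40)/(41).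
[cite: Balaban1985Averaging, (40) p.23] -/
theorem deriv_Z39_eq (X : 𝔸) {Y : 𝔸} (hY : ‖Y‖ ≤ 1 / 12) :
    deriv (Z39 X Y) 0 = fderiv ℂ exp Y X * exp (-Y) := by
  have hZ := hasDerivAt_Z39 X hY
  have hZ0 : Z39 X Y 0 = 0 := Z39_zero X Y
  have he : HasFDerivAt (exp : 𝔸 → 𝔸) (1 : 𝔸 →L[ℂ] 𝔸) (Z39 X Y 0) := by
    rw [hZ0]
    exact hasFDerivAt_exp_zero (𝕂 := ℂ)
  have h1 : HasDerivAt (fun u => exp (Z39 X Y u)) ((1 : 𝔸 →L[ℂ] 𝔸) (deriv (Z39 X Y) 0)) 0 :=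
    he.comp_hasDerivAt (0 : ℂ) hZ
  have h2 : HasDerivAt (fun u => exp (Z39 X Y u)) (fderiv ℂ exp ((0 : ℂ) • X + Y) X * exp (-Y)) 0 :=
    (hasDerivAt_exp_add_mul_exp_neg X Y 0).congr_of_eventuallyEq (exp_Z39_eventuallyEq X hY)
  have h := h1.unique h2
  rw [zero_smul, zero_add] at h
  simpa using h

/-! ## §5  (40)–(41): the same Taylor structure for `log e^{uX+Y}e^{−Y}` -/

/-- **THE REMAINDER OF (40)/(41), KERNEL FORM**, with an explicit constant where print has `O(|X|²)`: for `‖X‖ < 1/3`,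
`‖Y‖ ≤ 1/12` and `Z(u) = log e^{uX+Y}e^{−Y}` (39), `‖Z(1) − Z′(0)‖ ≤ 34‖X‖²` (`Z(0) = 0`; Cauchy/Schwarz estimate on
`|u| < 1/(3‖X‖)` with `‖Z(u)‖ ≤ 13/7`: `2·(13/7)·9 = 234/7 ≤ 34`). [cite: Balaban1985Averaging, (40)–(41) p.23] -/
theorem norm_remainder41_le {X Y : 𝔸} (hX : ‖X‖ < 1 / 3) (hY : ‖Y‖ ≤ 1 / 12) :
    ‖Z39 X Y 1 - deriv (Z39 X Y) 0‖ ≤ 34 * ‖X‖ ^ 2 := by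
  by_cases hX0 : X = 0
  · subst hX0
    have hc : Z39 (0 : 𝔸) Y = fun _ => 0 := by
      funext u
      simp only [Z39, smul_zero, zero_add, Literature.Analysis.Calculus.exp_mul_exp_neg, mlog_one]
    rw [hc]
    simp
  · have hXpos : 0 < ‖X‖ := norm_pos_iff.mpr hX0
    set ρ : ℝ := (3 * ‖X‖)⁻¹ with hρdef
    have h3 : 0 < 3 * ‖X‖ := by positivity
    have hρpos : 0 < ρ := inv_pos.mpr h3
    have hρX : ρ * ‖X‖ ≤ 1 / 3 := by
      rw [hρdef]
      field_simp
      nlinarith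
    have h1 : (1 : ℂ) ∈ ball (0 : ℂ) ρ := by
      rw [mem_ball_zero_iff, norm_one, hρdef, lt_inv_comm₀ one_pos h3, inv_one]
      linarith
    have hd := differentiableOn_Z39 X hY hρX
    have hB : ∀ t ∈ ball (0 : ℂ) ρ, ‖Z39 X Y t - Z39 X Y 0‖ ≤ 13 / 7 := by
      intro t ht
      rw [Z39_zero, sub_zero]
      exact norm_Z39_le (norm_mul_le_third_of_mem_ball hρX ht) hY
    have h := norm_taylor_two_remainder_le hd hB h1
    rw [Z39_zero, sub_zero, one_smul, norm_one] at h
    have hρinv : (1 : ℝ) / ρ = 3 * ‖X‖ := by rw [hρdef, one_div, inv_inv]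
    rw [hρinv] at h
    calc ‖Z39 X Y 1 - deriv (Z39 X Y) 0‖ ≤ 2 * (13 / 7) * (3 * ‖X‖) ^ 2 := h
      _ ≤ 34 * ‖X‖ ^ 2 := by nlinarith [sq_nonneg ‖X‖]

/-- **`G40 X Y`** — the linear term of (41): `(1/i) ∂_u log e^{iuX+iY}e^{−iY}|_{u=0}` (in print `g(−i ad_Y)X`, by (40) and
[7, Thm. 2.14.3]; characterised by `deriv_Z39_eq`). [cite: Balaban1985Averaging, (41) p.23] -/
def G40 (X Y : 𝔸) : 𝔸 := (I⁻¹ : ℂ) • deriv (Z39 (I • X) (I • Y)) 0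

/-- **`R41 X Y`** — the `O(|X|²)` of (41): `(1/i)(Z(1) − Z′(0))` for `Z(u) = log e^{iuX+iY}e^{−iY}`.
[cite: Balaban1985Averaging, (41) p.23] -/
def R41 (X Y : 𝔸) : 𝔸 := (I⁻¹ : ℂ) • (Z39 (I • X) (I • Y) 1 - deriv (Z39 (I • X) (I • Y)) 0)

/-- **(41) AS PRINTED, WITH A CONSTANT** (p. 23): for `|X| < 1/3`, `|Y| ≤ 1/12`,
`(1/i) log e^{iX+iY}e^{−iY} = G40 X Y + R41 X Y` with `|R41 X Y| ≤ 34|X|²` (print: `= g(−i ad_Y)X + O(|X|²)`; the linear term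
`G40` is identified with `g(−i ad_Y)X` by [7, Thm. 2.14.3], not typed — see `deriv_Z39_eq`).
[cite: Balaban1985Averaging, (41) p.23] -/
theorem eq41_printed {X Y : 𝔸} (hX : ‖X‖ < 1 / 3) (hY : ‖Y‖ ≤ 1 / 12) :
    (I⁻¹ : ℂ) • mlog (exp (I • X + I • Y) * exp (-(I • Y))) = G40 X Y + R41 X Y ∧ ‖R41 X Y‖ ≤ 34 * ‖X‖ ^ 2 := by
  have hZ1 : Z39 (I • X) (I • Y) 1 = mlog (exp (I • X + I • Y) * exp (-(I • Y))) := by simp only [Z39, one_smul]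
  refine ⟨?_, ?_⟩
  · simp only [G40, R41, smul_sub, hZ1]
    abel
  · have hX' : ‖(I • X : 𝔸)‖ < 1 / 3 := by rwa [norm_I_smul']
    have hY' : ‖(I • Y : 𝔸)‖ ≤ 1 / 12 := by rwa [norm_I_smul']
    have h := norm_remainder41_le hX' hY'
    rw [norm_I_smul'] at h
    rw [R41, norm_Iinv_smul]
    exact h

/-! ## §6  (v1.1, APPEND-ONLY) The printed domain of (28), `|uX| < ⅛`, `|vY| < ⅛`: joint holomorphy in `(u, v)` and
both clauses of (36) characterised by the differential of `exp` -/

/-- `e^{1/4} ≤ 13/10` (`e^{1/4} = 1.2840…`): on the printed domain `‖e^{uX}e^{vY} − 1‖ ≤ e^{1/4} − 1 ≤ 3/10 < 1`. [folklore] -/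
theorem exp_quarter_le : Real.exp (1 / 4) ≤ 13 / 10 := by
  have h := exp_le_quartic (x := 1 / 4) (by norm_num) (by norm_num)
  have h2 : (1 : ℝ) + 1 / 4 + (1 / 4) ^ 2 / 2 + (1 / 4) ^ 3 / 6 + 5 * (1 / 4) ^ 4 / 96 ≤ 13 / 10 := by norm_num
  exact h.trans h2

/-- **(28) in both variables** (p. 22): `Z2 X Y (u, v) := log e^{uX}e^{vY}`, `(u, v) ∈ ℂ²`, `log` = the series (21); its
`u`-slices are the one-variable `Z28`: `Z2 X Y (u, v) = Z28 X (v • Y) u` (`Z2_eq_Z28`). [cite: Balaban1985Averaging, (28) p.22] -/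
def Z2 (X Y : 𝔸) (p : ℂ × ℂ) : 𝔸 := mlog (exp (p.1 • X) * exp (p.2 • Y))

omit [CompleteSpace 𝔸] in
/-- `Z(u, v) = Z28 X (v • Y) u` (the second variable absorbed into `Y`, as in §§2–5). [cite: Balaban1985Averaging, (28) p.22] -/
theorem Z2_eq_Z28 (X Y : 𝔸) (u v : ℂ) : Z2 X Y (u, v) = Z28 X (v • Y) u := rfl

omit [NormedAlgebra ℂ 𝔸] [CompleteSpace 𝔸] in
/-- **The printed domain** of p. 22, "`|uX| < ⅛`, `|vY| < ⅛`" (`|uX| = |u|·|X|` for the norm (19)): `dom28 X Y ⊆ ℂ²`.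
[cite: Balaban1985Averaging, (28) p.22] -/
def dom28 (X Y : 𝔸) : Set (ℂ × ℂ) := {p | ‖p.1‖ * ‖X‖ < 1 / 8 ∧ ‖p.2‖ * ‖Y‖ < 1 / 8}

omit [NormedAlgebra ℂ 𝔸] [CompleteSpace 𝔸] in
/-- Membership in the printed domain, unfolded. [folklore] -/
theorem mem_dom28 {X Y : 𝔸} {p : ℂ × ℂ} : p ∈ dom28 X Y ↔ ‖p.1‖ * ‖X‖ < 1 / 8 ∧ ‖p.2‖ * ‖Y‖ < 1 / 8 := Iff.rfl

omit [NormedAlgebra ℂ 𝔸] [CompleteSpace 𝔸] in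
/-- The printed domain is open in `ℂ²`. [folklore] -/
theorem isOpen_dom28 (X Y : 𝔸) : IsOpen (dom28 X Y) := by
  have h1 : Continuous fun p : ℂ × ℂ => ‖p.1‖ * ‖X‖ := (continuous_norm.comp continuous_fst).mul continuous_const
  have h2 : Continuous fun p : ℂ × ℂ => ‖p.2‖ * ‖Y‖ := (continuous_norm.comp continuous_snd).mul continuous_const
  exact (isOpen_lt h1 continuous_const).inter (isOpen_lt h2 continuous_const)

omit [NormedAlgebra ℂ 𝔸] [CompleteSpace 𝔸] in
/-- `(0, 0)` lies in the printed domain (for every `X`, `Y`). [folklore] -/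
theorem zero_mem_dom28 (X Y : 𝔸) : ((0 : ℂ), (0 : ℂ)) ∈ dom28 X Y := by
  simp [dom28]

/-- Radius bookkeeping on the printed domain: `|uX| < ⅛`, `|vY| < ⅛ ⟹ ‖e^{uX}e^{vY} − 1‖ < e^{1/4} − 1 ≤ 3/10` (`< 1`: inside
the disc of the series (21)). [folklore] -/
theorem norm_arg2_sub_one_lt {X Y : 𝔸} {p : ℂ × ℂ} (hp : p ∈ dom28 X Y) :
    ‖exp (p.1 • X) * exp (p.2 • Y) - 1‖ < 3 / 10 := by
  have h1 := norm_exp_mul_exp_sub_one_le (p.1 • X) (p.2 • Y)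
  obtain ⟨ha, hb⟩ := hp
  have h2 : ‖p.1 • X‖ + ‖p.2 • Y‖ < 1 / 4 := by rw [norm_smul, norm_smul]; linarith
  have h3 : Real.exp (‖p.1 • X‖ + ‖p.2 • Y‖) < Real.exp (1 / 4) := Real.exp_lt_exp.mpr h2
  linarith [exp_quarter_le]

/-- The path under the logarithm of (28), `(u, v) ↦ e^{uX}e^{vY}`, is jointly holomorphic on `ℂ²`. [folklore] -/
theorem differentiable_exp_smul_mul_exp_smul (X Y : 𝔸) :
    Differentiable ℂ fun p : ℂ × ℂ => exp (p.1 • X) * exp (p.2 • Y) := by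
  have hexp : Differentiable ℂ (exp : 𝔸 → 𝔸) := fun x => (exp_analytic (𝕂 := ℂ) x).differentiableAt
  exact (hexp.comp (differentiable_fst.smul_const X)).mul (hexp.comp (differentiable_snd.smul_const Y))

/-- **"It is a well-defined and analytic function of `uX`, `vY`, for example, in the domain `|uX| < ⅛`, `|vY| < ⅛`."**
(p. 22, the sentence after (28)), typed ON THE PRINTED DOMAIN: `Z2 X Y = log e^{uX}e^{vY}` is (jointly) holomorphic in
`(u, v)` on `dom28 X Y` — there `‖e^{uX}e^{vY} − 1‖ < 3/10 < 1`, inside the disc of the series (21)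
(`Literature.Analysis.Complex.differentiableOn_logOnePlus_comp`).  Holomorphy on an open set of `ℂ²` is the typed reading of
"analytic". [cite: Balaban1985Averaging, (28) p.22] -/
theorem differentiableOn_Z2 (X Y : 𝔸) : DifferentiableOn ℂ (Z2 X Y) (dom28 X Y) := by
  have hW : DifferentiableOn ℂ (fun p : ℂ × ℂ => exp (p.1 • X) * exp (p.2 • Y) - 1) (dom28 X Y) :=
    ((differentiable_exp_smul_mul_exp_smul X Y).sub_const 1).differentiableOn
  have h1 : ∀ p ∈ dom28 X Y, ‖exp (p.1 • X) * exp (p.2 • Y) - 1‖ < 1 := fun p hp =>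
    (norm_arg2_sub_one_lt hp).trans (by norm_num)
  exact Literature.Analysis.Complex.differentiableOn_logOnePlus_comp hW h1

/-- `Z2 X Y` is (Fréchet-)differentiable at every point of the printed domain (which is open). [cite: Balaban1985Averaging, (28) p.22] -/
theorem differentiableAt_Z2 {X Y : 𝔸} {p : ℂ × ℂ} (hp : p ∈ dom28 X Y) : DifferentiableAt ℂ (Z2 X Y) p :=
  (differentiableOn_Z2 X Y).differentiableAt ((isOpen_dom28 X Y).mem_nhds hp)

/-- "well-defined" (p. 22): on the printed domain `log` inverts `exp`, `e^{Z(u,v)} = e^{uX}e^{vY}` ("It is an inverse to the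
exponential function", p. 21; `MatrixLog.exp_mlog`). [cite: Balaban1985Averaging, (28) p.22] -/
theorem exp_Z2 {X Y : 𝔸} {p : ℂ × ℂ} (hp : p ∈ dom28 X Y) :
    exp (Z2 X Y p) = exp (p.1 • X) * exp (p.2 • Y) :=
  exp_mlog ((norm_arg2_sub_one_lt hp).trans (by norm_num))

/-- The `u`-slice `u' ↦ Z(u', v)` is differentiable at `u` when `(u, v)` is in the printed domain. [folklore] -/
theorem differentiableAt_slice_fst_Z2 {X Y : 𝔸} {u v : ℂ} (hp : (u, v) ∈ dom28 X Y) :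
    DifferentiableAt ℂ (fun u' : ℂ => Z2 X Y (u', v)) u := by
  have hf : DifferentiableAt ℂ (fun u' : ℂ => (u', v)) u :=
    differentiableAt_fun_id.prodMk (differentiableAt_const v)
  have hg : DifferentiableAt ℂ (Z2 X Y) ((fun u' : ℂ => (u', v)) u) := differentiableAt_Z2 hp
  exact DifferentiableAt.comp (g := Z2 X Y) (f := fun u' : ℂ => (u', v)) u hg hf

/-- The `v`-slice `v' ↦ Z(u, v')` is differentiable at `v` when `(u, v)` is in the printed domain. [folklore] -/
theorem differentiableAt_slice_snd_Z2 {X Y : 𝔸} {u v : ℂ} (hp : (u, v) ∈ dom28 X Y) :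
    DifferentiableAt ℂ (fun v' : ℂ => Z2 X Y (u, v')) v := by
  have hf : DifferentiableAt ℂ (fun v' : ℂ => (u, v')) v :=
    (differentiableAt_const u).prodMk differentiableAt_fun_id
  have hg : DifferentiableAt ℂ (Z2 X Y) ((fun v' : ℂ => (u, v')) v) := differentiableAt_Z2 hp
  exact DifferentiableAt.comp (g := Z2 X Y) (f := fun v' : ℂ => (u, v')) v hg hf

/-- The `u`-slice of the printed domain: for `|v|·|Y| < ⅛`, `u ↦ Z(u, v) = Z28 X (v • Y) u` is holomorphic on
`{u : |u|·|X| < ⅛}`. [cite: Balaban1985Averaging, (28) p.22] -/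
theorem differentiableOn_Z28_printed (X : 𝔸) {Y : 𝔸} {v : ℂ} (hv : ‖v‖ * ‖Y‖ < 1 / 8) :
    DifferentiableOn ℂ (Z28 X (v • Y)) {u : ℂ | ‖u‖ * ‖X‖ < 1 / 8} := by
  intro u hu
  have hp : (u, v) ∈ dom28 X Y := ⟨hu, hv⟩
  have h := differentiableAt_slice_fst_Z2 hp
  exact h.differentiableWithinAt

/-- `e^{Z(u', v)} = e^{u'X}e^{vY}` for `u'` near `u`, when `(u, v)` is in the (open) printed domain. [folklore] -/
theorem exp_Z2_slice_fst_eventuallyEq {X Y : 𝔸} {u v : ℂ} (hp : (u, v) ∈ dom28 X Y) :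
    (fun u' : ℂ => exp (Z2 X Y (u', v))) =ᶠ[𝓝 u] fun u' => exp (u' • X) * exp (v • Y) := by
  have hopen : IsOpen {u' : ℂ | (u', v) ∈ dom28 X Y} := (isOpen_dom28 X Y).preimage (Continuous.prodMk_left v)
  filter_upwards [hopen.mem_nhds hp] with u' hu'
  exact exp_Z2 hu'

/-- `e^{Z(u, v')} = e^{uX}e^{v'Y}` for `v'` near `v`, when `(u, v)` is in the printed domain. [folklore] -/
theorem exp_Z2_slice_snd_eventuallyEq {X Y : 𝔸} {u v : ℂ} (hp : (u, v) ∈ dom28 X Y) :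
    (fun v' : ℂ => exp (Z2 X Y (u, v'))) =ᶠ[𝓝 v] fun v' => exp (u • X) * exp (v' • Y) := by
  have hopen : IsOpen {v' : ℂ | (u, v') ∈ dom28 X Y} := (isOpen_dom28 X Y).preimage (Continuous.prodMk_right u)
  filter_upwards [hopen.mem_nhds hp] with v' hv'
  exact exp_Z2 hv'

/-- **(36), FIRST CLAUSE, CHARACTERISED ON THE PRINTED DOMAIN.**  For `(u, v) ∈ dom28 X Y` the partial derivative
`∂Z/∂u (u, v)` (`deriv (fun u' => Z2 X Y (u', v)) u`) satisfies `D exp_{Z(u,v)} (∂Z/∂u) = X · e^{Z(u,v)}`: differentiate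
`e^{Z(u',v)} = e^{u'X}e^{vY}` at `u' = u` (chain rule through the Fréchet derivative of `exp`, uniqueness of derivatives,
`e^{uX}X = Xe^{uX}`).  With [7, Thm. 2.14.3] = (32), `D exp_Z(h) = (g(−ad_Z)h) e^{Z}`, this reads `g(−ad_Z)(∂Z/∂u) = X`, i.e.
the printed `∂Z(u,v)/∂u = g^{−1}(−ad_{Z(u,v)})X` (the inversion of `g(−ad_Z)` for small `Z` is [7] + (33)–(34), not typed).
[cite: Balaban1985Averaging, (36) p.23] -/
theorem fderiv_exp_partial_fst_Z2 {X Y : 𝔸} {u v : ℂ} (hp : (u, v) ∈ dom28 X Y) :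
    fderiv ℂ exp (Z2 X Y (u, v)) (deriv (fun u' : ℂ => Z2 X Y (u', v)) u) = X * exp (Z2 X Y (u, v)) := by
  have hZ : HasDerivAt (fun u' : ℂ => Z2 X Y (u', v)) (deriv (fun u' : ℂ => Z2 X Y (u', v)) u) u :=
    (differentiableAt_slice_fst_Z2 hp).hasDerivAt
  have he : HasFDerivAt (exp : 𝔸 → 𝔸) (fderiv ℂ exp (Z2 X Y (u, v))) (Z2 X Y (u, v)) :=
    (exp_analytic (𝕂 := ℂ) (Z2 X Y (u, v))).differentiableAt.hasFDerivAt
  have h1 : HasDerivAt (fun u' : ℂ => exp (Z2 X Y (u', v)))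
      (fderiv ℂ exp (Z2 X Y (u, v)) (deriv (fun u' : ℂ => Z2 X Y (u', v)) u)) u :=
    he.comp_hasDerivAt u hZ
  have h2 : HasDerivAt (fun u' : ℂ => exp (Z2 X Y (u', v))) (exp (u • X) * X * exp (v • Y)) u :=
    (hasDerivAt_exp_smul_mul_exp X (v • Y) u).congr_of_eventuallyEq (exp_Z2_slice_fst_eventuallyEq hp)
  have h := h1.unique h2
  have hc : exp (u • X) * X = X * exp (u • X) := (((Commute.refl X).smul_left u).exp_left).eq
  rw [h, exp_Z2 hp, hc, mul_assoc]

/-- **(36), SECOND CLAUSE, CHARACTERISED ON THE PRINTED DOMAIN.**  For `(u, v) ∈ dom28 X Y` the partial derivative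
`∂Z/∂v (u, v)` satisfies `D exp_{Z(u,v)} (∂Z/∂v) = e^{Z(u,v)} · Y` (differentiate `e^{Z(u,v')} = e^{uX}e^{v'Y}` at `v' = v`).
With (32), `D exp_Z(h) = e^{Z} g(ad_Z) h`, this reads `g(ad_Z)(∂Z/∂v) = Y`, i.e. the printed `∂Z(u,v)/∂v = g^{−1}(ad_{Z(u,v)})Y`.
[cite: Balaban1985Averaging, (36) p.23] -/
theorem fderiv_exp_partial_snd_Z2 {X Y : 𝔸} {u v : ℂ} (hp : (u, v) ∈ dom28 X Y) :
    fderiv ℂ exp (Z2 X Y (u, v)) (deriv (fun v' : ℂ => Z2 X Y (u, v')) v) = exp (Z2 X Y (u, v)) * Y := by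
  have hZ : HasDerivAt (fun v' : ℂ => Z2 X Y (u, v')) (deriv (fun v' : ℂ => Z2 X Y (u, v')) v) v :=
    (differentiableAt_slice_snd_Z2 hp).hasDerivAt
  have he : HasFDerivAt (exp : 𝔸 → 𝔸) (fderiv ℂ exp (Z2 X Y (u, v))) (Z2 X Y (u, v)) :=
    (exp_analytic (𝕂 := ℂ) (Z2 X Y (u, v))).differentiableAt.hasFDerivAt
  have h1 : HasDerivAt (fun v' : ℂ => exp (Z2 X Y (u, v')))
      (fderiv ℂ exp (Z2 X Y (u, v)) (deriv (fun v' : ℂ => Z2 X Y (u, v')) v)) v :=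
    he.comp_hasDerivAt v hZ
  have h2 : HasDerivAt (fun v' : ℂ => exp (Z2 X Y (u, v'))) (exp (u • X) * (exp (v • Y) * Y)) v :=
    ((hasDerivAt_exp_smul_const (𝕂 := ℂ) Y v).const_mul (exp (u • X))).congr_of_eventuallyEq
      (exp_Z2_slice_snd_eventuallyEq hp)
  have h := h1.unique h2
  rw [h, exp_Z2 hp, mul_assoc]

/-- At the origin of the printed domain both characterisations specialise to `D exp_0 = id`: `∂Z/∂u (0, 0) = X` and
`∂Z/∂v (0, 0) = Y` (the constant terms `g^{−1}(0) = 1` of (34)). [cite: Balaban1985Averaging, (34), (36) p.23] -/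
theorem partials_Z2_at_zero (X Y : 𝔸) :
    deriv (fun u' : ℂ => Z2 X Y (u', 0)) 0 = X ∧ deriv (fun v' : ℂ => Z2 X Y (0, v')) 0 = Y := by
  have hp := zero_mem_dom28 X Y
  have hZ0 : Z2 X Y ((0 : ℂ), (0 : ℂ)) = 0 := by
    simp only [Z2, zero_smul, exp_zero, mul_one, mlog_one]
  have hD : fderiv ℂ exp (Z2 X Y ((0 : ℂ), (0 : ℂ))) = (1 : 𝔸 →L[ℂ] 𝔸) := by
    rw [hZ0]; exact (hasFDerivAt_exp_zero (𝕂 := ℂ)).fderiv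
  have h1 := fderiv_exp_partial_fst_Z2 hp
  have h2 := fderiv_exp_partial_snd_Z2 hp
  rw [hD, hZ0, exp_zero] at h1 h2
  simp only [one_apply_eq_self, mul_one, one_mul] at h1 h2
  exact ⟨h1, h2⟩

end Algebra

end Literature.MathematicalPhysics.QuantumFieldTheory.Balaban1983to89.B7Eq38Remainder
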